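import Mathlib
import Summits.SmoothPoincare4.SmoothPoincare4.Statement
import Literature.Topology.FourManifolds.IntersectionNumbers
import Literature.Topology.FourManifolds.SphereFamilySurgery
import Literature.Topology.FourManifolds.ConnectedSum

/-! Strategist sketch (unit cstrat-stmt-SmoothPoincare4-15789-r1, crux `OneSummandCommonDuals`, route CommonDualRelay).

* `OneSummandCommonDuals` — the crux verbatim (rev 4).
* `FramedImmersedCommonDuals` (D3a), `EmbeddingRelay` (D3b) — the typed two-stage split along the
  Auckly–Kim–Melvin–Ruberman–Schwartz proof (immersed common duals with trivialised normal bundles, then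
  embedding + separation using the ONE free pair); `oneSummandCommonDuals_of_split : D3a → D3b → R` (logic).
* `OneSummandCarrier` (R′) — the RECOMMENDED restatement (diffeomorphism-carrier form = the conclusion `closes`
  actually consumes, merging `GabaiSystemsLightBulb`), with `FramedImmersedCommonDualsUpToDiffeo` (D3a′) and
  `oneSummandCarrier_of_split : D3a′ → D3b → GabaiSystemsLightBulb → R′` (logic + `Set.range_comp`).
-/

namespace Summit.SmoothPoincare4.SmoothPoincare4.Cruxes.OneSummandCommonDuals.Strategist

open scoped Manifold ContinuousMap

set_option linter.dupNamespace false

/-- The crux verbatim (route CommonDualRelay rev 4, item stmt-SmoothPoincare4-15789). -/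
def OneSummandCommonDuals : Prop :=
  open scoped ContDiff in ∀ (N : Type) [TopologicalSpace N] [T2Space N] [SecondCountableTopology N] [ChartedSpace (EuclideanSpace ℝ (Fin 4)) N] [IsManifold (𝓡 4) ∞ N] [CompactSpace N] [SimplyConnectedSpace N] (oN : Literature.Topology.FourManifolds.SmoothOrientation (𝓡 4) N) (oS : Literature.Topology.FourManifolds.SmoothOrientation (𝓡 2) (Metric.sphere (0 : EuclideanSpace ℝ (Fin 3)) 1)) (k : ℕ) (A G C P : Literature.Topology.FourManifolds.FramedSphereFamily (𝓡 4) N (Fin k) 2 2) (F T : Literature.Topology.FourManifolds.FramedSphereFamily (𝓡 4) N (Fin 1) 2 2), Literature.Topology.FourManifolds.IsGeometricallyDual (𝓡 2) (𝓡 2) (𝓡 4) two_add_two_eq_four oS oS oN G.sphere A.sphere → Literature.Topology.FourManifolds.IsGeometricallyDual (𝓡 2) (𝓡 2) (𝓡 4) two_add_two_eq_four oS oS oN C.sphere P.sphere → (∀ i, (⟨A.sphere i, A.continuous_sphere i⟩ : C(↥(Metric.sphere (0 : EuclideanSpace ℝ (Fin 3)) 1), N)).Homotopic ⟨C.sphere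 i, C.continuous_sphere i⟩) → Literature.Topology.FourManifolds.IsGeometricallyDual (𝓡 2) (𝓡 2) (𝓡 4) two_add_two_eq_four oS oS oN F.sphere T.sphere → Disjoint (F.cores ∪ T.cores) (A.cores ∪ G.cores ∪ C.cores ∪ P.cores) → ∃ σ : Literature.Topology.FourManifolds.FramedSphereFamily (𝓡 4) N (Fin k) 2 2, Literature.Topology.FourManifolds.IsGeometricallyDual (𝓡 2) (𝓡 2) (𝓡 4) two_add_two_eq_four oS oS oN σ.sphere A.sphere ∧ Literature.Topology.FourManifolds.IsGeometricallyDual (𝓡 2) (𝓡 2) (𝓡 4) two_add_two_eq_four oS oS oN σ.sphere C.sphere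

/-- D3a — IMMERSED STAGE for the GIVEN pair of systems: framed-immersed common duals (maps of `S² × ℝ²` that are local
diffeomorphisms; their zero sections are immersed spheres with trivialised normal bundle, hence even homological square),
geometrically dual (as maps) to both `A` and `C`, disjoint from the free pair. -/
def FramedImmersedCommonDuals : Prop :=
  open scoped ContDiff in ∀ (N : Type) [TopologicalSpace N] [T2Space N] [SecondCountableTopology N] [ChartedSpace (EuclideanSpace ℝ (Fin 4)) N] [IsManifold (𝓡 4) ∞ N] [CompactSpace N] [SimplyConnectedSpace N] (oN : Literature.Topology.FourManifolds.SmoothOrientation (𝓡 4) N) (oS : Literature.Topology.FourManifolds.SmoothOrientation (𝓡 2) (Metric.sphere (0 : EuclideanSpace ℝ (Fin 3)) 1)) (k : ℕ) (A G C P : Literature.Topology.FourManifolds.FramedSphereFamily (𝓡 4) N (Fin k) 2 2) (F T : Literature.Topology.FourManifolds.FramedSphereFamily (𝓡 4) N (Fin 1) 2 2), Literature.Topology.FourManifolds.IsGeometricallyDual (𝓡 2) (𝓡 2) (𝓡 4) two_add_two_eq_four oS oS oN G.sphere A.sphere → Literature.Topology.FourManifolds.IsGeometricallyDual (𝓡 2)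 (𝓡 2) (𝓡 4) two_add_two_eq_four oS oS oN C.sphere P.sphere → (∀ i, (⟨A.sphere i, A.continuous_sphere i⟩ : C(↥(Metric.sphere (0 : EuclideanSpace ℝ (Fin 3)) 1), N)).Homotopic ⟨C.sphere i, C.continuous_sphere i⟩) → Literature.Topology.FourManifolds.IsGeometricallyDual (𝓡 2) (𝓡 2) (𝓡 4) two_add_two_eq_four oS oS oN F.sphere T.sphere → Disjoint (F.cores ∪ T.cores) (A.cores ∪ G.cores ∪ C.cores ∪ P.cores) → ∃ ψ : Fin k → ↥(Metric.sphere (0 : EuclideanSpace ℝ (Fin 3)) 1) × (EuclideanSpace ℝ (Fin 2)) → N, (∀ i, IsLocalDiffeomorph ((𝓡 2).prod 𝓘(ℝ, (EuclideanSpace ℝ (Fin 2)))) (𝓡 4) ∞ (ψ i)) ∧ Literature.Topology.FourManifolds.IsGeometricallyDual (𝓡 2) (𝓡 2) (𝓡 4) two_add_two_eq_four oS oS oN (fun i v => ψ i (v, 0)) A.sphere ∧ Literature.Topology.FourManifolds.IsGeometricallyDual (𝓡 2) (𝓡 2) (𝓡 4) two_add_two_eq_four oS oS oN (fun i v => ψ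 i (v, 0)) C.sphere ∧ Disjoint (F.cores ∪ T.cores) (⋃ i, Set.range (ψ i))

/-- D3b — EMBEDDING RELAY (the summand budget): `k` framed-immersed common duals + ONE free framed dual pair `(F, T)`
⇒ `k` pairwise disjoint EMBEDDED framed common duals.  `k = 1` is the embedding step of AucklyEtAl2019 (p. 4: tube into
`S`, Norman trick along `T`, square fixed by copies of `T`); `k ≥ 2` is open. -/
def EmbeddingRelay : Prop :=
  open scoped ContDiff in ∀ (N : Type) [TopologicalSpace N] [T2Space N] [SecondCountableTopology N] [ChartedSpace (EuclideanSpace ℝ (Fin 4)) N] [IsManifold (𝓡 4) ∞ N] [CompactSpace N] [SimplyConnectedSpace N] (oN : Literature.Topology.FourManifolds.SmoothOrientation (𝓡 4) N) (oS : Literature.Topology.FourManifolds.SmoothOrientation (𝓡 2) (Metric.sphere (0 : EuclideanSpace ℝ (Fin 3)) 1)) (k : ℕ) (A G C P : Literature.Topology.FourManifolds.FramedSphereFamily (𝓡 4) N (Fin k) 2 2) (F T : Literature.Topology.FourManifolds.FramedSphereFamily (𝓡 4) N (Fin 1) 2 2) (ψ : Fin k → ↥(Metric.sphere (0 : EuclideanSpace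 ℝ (Fin 3)) 1) × (EuclideanSpace ℝ (Fin 2)) → N), (∀ i, IsLocalDiffeomorph ((𝓡 2).prod 𝓘(ℝ, (EuclideanSpace ℝ (Fin 2)))) (𝓡 4) ∞ (ψ i)) → Literature.Topology.FourManifolds.IsGeometricallyDual (𝓡 2) (𝓡 2) (𝓡 4) two_add_two_eq_four oS oS oN G.sphere A.sphere → Literature.Topology.FourManifolds.IsGeometricallyDual (𝓡 2) (𝓡 2) (𝓡 4) two_add_two_eq_four oS oS oN C.sphere P.sphere → Literature.Topology.FourManifolds.IsGeometricallyDual (𝓡 2) (𝓡 2) (𝓡 4) two_add_two_eq_four oS oS oN (fun i v => ψ i (v, 0)) A.sphere → Literature.Topology.FourManifolds.IsGeometricallyDual (𝓡 2) (𝓡 2) (𝓡 4) two_add_two_eq_four oS oS oN (fun i v => ψ i (v, 0)) C.sphere → Literature.Topology.FourManifolds.IsGeometricallyDual (𝓡 2) (𝓡 2) (𝓡 4) two_add_two_eq_four oS oS oN F.sphere T.sphere → Disjoint (F.cores ∪ T.cores) (A.cores ∪ G.cores ∪ C.cores ∪ P.cores ∪ ⋃ i, Set.range (ψ i)) → ∃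 σ : Literature.Topology.FourManifolds.FramedSphereFamily (𝓡 4) N (Fin k) 2 2, Literature.Topology.FourManifolds.IsGeometricallyDual (𝓡 2) (𝓡 2) (𝓡 4) two_add_two_eq_four oS oS oN σ.sphere A.sphere ∧ Literature.Topology.FourManifolds.IsGeometricallyDual (𝓡 2) (𝓡 2) (𝓡 4) two_add_two_eq_four oS oS oN σ.sphere C.sphere

/-- R′ — RECOMMENDED RESTATEMENT (carrier form): the configuration of the crux ⇒ a self-diffeomorphism of `N` carrying
each `Aᵢ` onto `Cᵢ` as image spheres (exactly the conclusion of `GabaiSystemsLightBulb`, which `closes` feeds to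
`SurgeryImageInvariance`).  `k = 1` IS AucklyEtAl2019 Theorem (p. 4) + Gabai2020 Thm 10.1 in print. -/
def OneSummandCarrier : Prop :=
  open scoped ContDiff in ∀ (N : Type) [TopologicalSpace N] [T2Space N] [SecondCountableTopology N] [ChartedSpace (EuclideanSpace ℝ (Fin 4)) N] [IsManifold (𝓡 4) ∞ N] [CompactSpace N] [SimplyConnectedSpace N] (oN : Literature.Topology.FourManifolds.SmoothOrientation (𝓡 4) N) (oS : Literature.Topology.FourManifolds.SmoothOrientation (𝓡 2) (Metric.sphere (0 : EuclideanSpace ℝ (Fin 3)) 1)) (k : ℕ) (A G C P : Literature.Topology.FourManifolds.FramedSphereFamily (𝓡 4) N (Fin k) 2 2) (F T : Literature.Topology.FourManifolds.FramedSphereFamily (𝓡 4) N (Fin 1) 2 2), Literature.Topology.FourManifolds.IsGeometricallyDual (𝓡 2) (𝓡 2) (𝓡 4) two_add_two_eq_four oS oS oN G.sphere A.sphere → Literature.Topology.FourManifolds.IsGeometricallyDual (𝓡 2) (𝓡 2) (𝓡 4) two_add_two_eq_four oS oS oN C.sphere P.sphere → (∀ i, (⟨A.sphere i, A.continuous_sphere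 i⟩ : C(↥(Metric.sphere (0 : EuclideanSpace ℝ (Fin 3)) 1), N)).Homotopic ⟨C.sphere i, C.continuous_sphere i⟩) → Literature.Topology.FourManifolds.IsGeometricallyDual (𝓡 2) (𝓡 2) (𝓡 4) two_add_two_eq_four oS oS oN F.sphere T.sphere → Disjoint (F.cores ∪ T.cores) (A.cores ∪ G.cores ∪ C.cores ∪ P.cores) → ∃ φ : N ≃ₘ⟮𝓡 4, 𝓡 4⟯ N, ∀ i, Set.range (φ ∘ A.sphere i) = Set.range (C.sphere i)

/-- D3a′ — immersed stage UP TO A DIFFEOMORPHISM of the `A`-side (finger moves of `A` across `C` allowed, as in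
AucklyEtAl2019 p. 4 L32): some diffeomorphic image `A′` of the system `A`, with its own dual system `G′` and
`A′ᵢ ≃ Cᵢ`, has framed-immersed common duals with `C`. -/
def FramedImmersedCommonDualsUpToDiffeo : Prop :=
  open scoped ContDiff in ∀ (N : Type) [TopologicalSpace N] [T2Space N] [SecondCountableTopology N] [ChartedSpace (EuclideanSpace ℝ (Fin 4)) N] [IsManifold (𝓡 4) ∞ N] [CompactSpace N] [SimplyConnectedSpace N] (oN : Literature.Topology.FourManifolds.SmoothOrientation (𝓡 4) N) (oS : Literature.Topology.FourManifolds.SmoothOrientation (𝓡 2) (Metric.sphere (0 : EuclideanSpace ℝ (Fin 3)) 1)) (k : ℕ) (A G C P : Literature.Topology.FourManifolds.FramedSphereFamily (𝓡 4) N (Fin k) 2 2) (F T : Literature.Topology.FourManifolds.FramedSphereFamily (𝓡 4) N (Fin 1) 2 2), Literature.Topology.FourManifolds.IsGeometricallyDual (𝓡 2) (𝓡 2) (𝓡 4) two_add_two_eq_four oS oS oN G.sphere A.sphere → Literature.Topology.FourManifolds.IsGeometricallyDual (𝓡 2) (𝓡 2) (𝓡 4) two_add_two_eq_four oS oS oN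 C.sphere P.sphere → (∀ i, (⟨A.sphere i, A.continuous_sphere i⟩ : C(↥(Metric.sphere (0 : EuclideanSpace ℝ (Fin 3)) 1), N)).Homotopic ⟨C.sphere i, C.continuous_sphere i⟩) → Literature.Topology.FourManifolds.IsGeometricallyDual (𝓡 2) (𝓡 2) (𝓡 4) two_add_two_eq_four oS oS oN F.sphere T.sphere → Disjoint (F.cores ∪ T.cores) (A.cores ∪ G.cores ∪ C.cores ∪ P.cores) → ∃ (χ : N ≃ₘ⟮𝓡 4, 𝓡 4⟯ N) (A' G' : Literature.Topology.FourManifolds.FramedSphereFamily (𝓡 4) N (Fin k) 2 2) (ψ : Fin k → ↥(Metric.sphere (0 : EuclideanSpace ℝ (Fin 3)) 1) × (EuclideanSpace ℝ (Fin 2)) → N), (∀ i, Set.range (A'.sphere i) = Set.range (χ ∘ A.sphere i)) ∧ Literature.Topology.FourManifolds.IsGeometricallyDual (𝓡 2) (𝓡 2) (𝓡 4) two_add_two_eq_four oS oS oN G'.sphere A'.sphere ∧ (∀ i, (⟨A'.sphere i, A'.continuous_sphere i⟩ : C(↥(Metric.sphere (0 : EuclideanSpace ℝ (Fin 3)) 1),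 N)).Homotopic ⟨C.sphere i, C.continuous_sphere i⟩) ∧ (∀ i, IsLocalDiffeomorph ((𝓡 2).prod 𝓘(ℝ, (EuclideanSpace ℝ (Fin 2)))) (𝓡 4) ∞ (ψ i)) ∧ Literature.Topology.FourManifolds.IsGeometricallyDual (𝓡 2) (𝓡 2) (𝓡 4) two_add_two_eq_four oS oS oN (fun i v => ψ i (v, 0)) A'.sphere ∧ Literature.Topology.FourManifolds.IsGeometricallyDual (𝓡 2) (𝓡 2) (𝓡 4) two_add_two_eq_four oS oS oN (fun i v => ψ i (v, 0)) C.sphere ∧ Disjoint (F.cores ∪ T.cores) (A'.cores ∪ G'.cores ∪ ⋃ i, Set.range (ψ i))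

/-- Copy of the route's fact-gate item `GabaiSystemsLightBulb` (stmt-SmoothPoincare4-15792), verbatim. -/
def GabaiSystemsLightBulb : Prop :=
  open scoped ContDiff in ∀ (N : Type) [TopologicalSpace N] [T2Space N] [SecondCountableTopology N] [ChartedSpace (EuclideanSpace ℝ (Fin 4)) N] [IsManifold (𝓡 4) ∞ N] [CompactSpace N] [SimplyConnectedSpace N] (oN : Literature.Topology.FourManifolds.SmoothOrientation (𝓡 4) N) (oS : Literature.Topology.FourManifolds.SmoothOrientation (𝓡 2) (Metric.sphere (0 : EuclideanSpace ℝ (Fin 3)) 1)) (k : ℕ) (A C σ : Literature.Topology.FourManifolds.FramedSphereFamily (𝓡 4) N (Fin k) 2 2), Literature.Topology.FourManifolds.IsGeometricallyDual (𝓡 2) (𝓡 2) (𝓡 4) two_add_two_eq_four oS oS oN σ.sphere A.sphere → Literature.Topology.FourManifolds.IsGeometricallyDual (𝓡 2) (𝓡 2) (𝓡 4) two_add_two_eq_four oS oS oN σ.sphere C.sphere → (∀ i, (⟨A.sphere i, A.continuous_sphere i⟩ : C(↥(Metric.sphere (0 : EuclideanSpace ℝ (Fin 3)) 1), N)).Homotopic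 ⟨C.sphere i, C.continuous_sphere i⟩) → ∃ φ : N ≃ₘ⟮𝓡 4, 𝓡 4⟯ N, ∀ i, Set.range (φ ∘ A.sphere i) = Set.range (C.sphere i)

/-- Split assembly for the crux AS TYPED: D3a → D3b → R (pure logic). -/
theorem oneSummandCommonDuals_of_split (h₁ : FramedImmersedCommonDuals) (h₂ : EmbeddingRelay) :
    OneSummandCommonDuals := by
  intro N _ _ _ _ _ _ _ oN oS k A G C P F T hGA hCP hAC hFT hdisj
  obtain ⟨ψ, hψ, hψA, hψC, hdisjψ⟩ := h₁ N oN oS k A G C P F T hGA hCP hAC hFT hdisj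
  exact h₂ N oN oS k A G C P F T ψ hψ hGA hCP hψA hψC hFT (Disjoint.union_right hdisj hdisjψ)

/-- Split assembly for the RECOMMENDED restatement: D3a′ → D3b → Gabai 10.1 → R′. -/
theorem oneSummandCarrier_of_split (h₁ : FramedImmersedCommonDualsUpToDiffeo) (h₂ : EmbeddingRelay)
    (hG : GabaiSystemsLightBulb) : OneSummandCarrier := by
  intro N _ _ _ _ _ _ _ oN oS k A G C P F T hGA hCP hAC hFT hdisj
  obtain ⟨χ, A', G', ψ, hA', hG'A', hA'C, hψ, hψA', hψC, hdisj'⟩ := h₁ N oN oS k A G C P F T hGA hCP hAC hFT hdisj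
  have hdisjC : Disjoint (F.cores ∪ T.cores) (C.cores ∪ P.cores) := by
    refine hdisj.mono_right ?_
    intro x hx
    rcases hx with hx | hx
    · exact Or.inl (Or.inr hx)
    · exact Or.inr hx
  have hbig : Disjoint (F.cores ∪ T.cores) (A'.cores ∪ G'.cores ∪ C.cores ∪ P.cores ∪ ⋃ i, Set.range (ψ i)) := by
    have h1 : Disjoint (F.cores ∪ T.cores) (A'.cores ∪ G'.cores) :=
      hdisj'.mono_right (by intro x hx; exact Or.inl hx)
    have h2 : Disjoint (F.cores ∪ T.cores) (⋃ i, Set.range (ψ i)) :=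
      hdisj'.mono_right (by intro x hx; exact Or.inr hx)
    have h3 : Disjoint (F.cores ∪ T.cores) (A'.cores ∪ G'.cores ∪ C.cores ∪ P.cores) := by
      have := Disjoint.union_right h1 hdisjC
      simpa [Set.union_assoc] using this
    exact Disjoint.union_right h3 h2
  obtain ⟨σ, hσA', hσC⟩ := h₂ N oN oS k A' G' C P F T ψ hψ hG'A' hCP hψA' hψC hFT hbig
  obtain ⟨φ', hφ'⟩ := hG N oN oS k A' C σ hσA' hσC hA'C
  refine ⟨χ.trans φ', fun i => ?_⟩
  rw [← hφ' i]
  (simp only [Set.range_comp, hA' i, Set.image_image, Diffeomorph.coe_trans]) <;> rfl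

end Summit.SmoothPoincare4.SmoothPoincare4.Cruxes.OneSummandCommonDuals.Strategist
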